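import Mathlib
import HarnessLib
import Summits.HubbardSuperconductivity.HubbardSuperconductivity.Theorems.WeakCouplingBCSKlCertFillingTools
import Literature.MathematicalPhysics.StatisticalMechanics.HardDiscStarLensSlice

/-!
# Route `WeakCouplingBCS` — support item `WcbcsKohnLuttingerB1g` (stmt-HubbardSuperconductivity-0158):
# certified fillings of the square-lattice band, II — reflection symmetry, cover bookkeeping, transport

Second tools file for the certified filling bounds (see `WeakCouplingBCSKlCertFillingTools.lean`;
`R_c = {(x, y) | |x + y| < π, |x - y| < π, c < cos x + cos y}` is the coordinate Fermi sea):

* `klfill_volume_neg_half` — `vol(R_c ∩ {x < 0}) = vol(R_c ∩ {0 < x})` (the reflection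
  `(x, y) ↦ (-x, y)` preserves Lebesgue measure and the axis `{x = 0}` is null — both reused from the
  tree's `HardDiscStarLens.measurePreserving_reflect` / `volume_axis`); hence `vol(R_c) ≤ 2 vol(R_c ∩ {0 < x})`
  (`klfill_volume_le_two_mul_half`) and `2 vol(U) ≤ vol(R_c)` for `U ⊆ R_c ∩ {0 < x}`
  (`klfill_two_mul_le_volume`);
* `klfill_cover_start` / `klfill_cover_step` / `klfill_volume_le_of_cover` — subadditive bookkeeping
  of a cover of `R_c ∩ {0 < x}` by trapezoids over consecutive `x`-intervals up to a vertical cut;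
* `klfill_occupied_subset_preimage` / `klfill_volume_occupied_le` — transport: for `c > 0` the
  occupied region `{ε₀ < -2c} ∩ BZ` is carried INTO `R_c` by `k ↦ (k₀, k₁)`
  (`measurePreserving_momentum_prod`), so `vol({ε₀ < -2c} ∩ BZ) ≤ vol(R_c)` (with the tree's
  `volume_fermiSeaCoord_le` an equality);
* `klfill_filling_le_of_volume_le` / `klfill_le_filling_of_le_volume` — from a rational area bound to
  the filling bound, with `3.141592 < π < 3.141593` (`Real.pi_gt_d6`, `Real.pi_lt_d6`).

Folklore; no definitions.
-/

noncomputable section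

-- the tree's namespace `Summit.<Summit>.<Problem>.Theorems` repeats the summit name by design (D-0017)
set_option linter.dupNamespace false

namespace Summit.HubbardSuperconductivity.HubbardSuperconductivity.Theorems

open MeasureTheory Set Literature.MathematicalPhysics.QuantumLattice

/-! ### Symmetry `x ↦ -x` and the null axis -/

/-- **Reflection symmetry of the Fermi sea**: `vol(R_c ∩ {x < 0}) = vol(R_c ∩ {0 < x})`.
[folklore] -/
theorem klfill_volume_neg_half (c : ℝ) :
    volume ({q : ℝ × ℝ | |q.1 + q.2| < Real.pi ∧ |q.1 - q.2| < Real.pi ∧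
        c < Real.cos q.1 + Real.cos q.2} ∩ {q | q.1 < 0}) =
      volume ({q : ℝ × ℝ | |q.1 + q.2| < Real.pi ∧ |q.1 - q.2| < Real.pi ∧
        c < Real.cos q.1 + Real.cos q.2} ∩ {q | 0 < q.1}) := by
  have hmeas : MeasurableSet ({q : ℝ × ℝ | |q.1 + q.2| < Real.pi ∧ |q.1 - q.2| < Real.pi ∧
      c < Real.cos q.1 + Real.cos q.2} ∩ {q | 0 < q.1}) :=
    (measurableSet_fermiSeaCoord c).inter (measurableSet_lt measurable_const measurable_fst)
  rw [← Literature.MathematicalPhysics.StatisticalMechanics.HardDiscStarLens.measurePreserving_reflect.measure_preimage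
    hmeas.nullMeasurableSet]
  congr 1
  ext ⟨x, y⟩
  simp only [mem_preimage, mem_inter_iff, mem_setOf_eq]
  constructor
  · rintro ⟨h, hx⟩
    exact ⟨fermiSeaCoord_neg_fst h, by linarith⟩
  · rintro ⟨h, hx⟩
    have := fermiSeaCoord_neg_fst h
    simp only [neg_neg] at this
    exact ⟨this, by linarith⟩

/-- **Splitting at the axis**: `vol(R_c) ≤ 2 · vol(R_c ∩ {0 < x})`. [folklore] -/
theorem klfill_volume_le_two_mul_half (c : ℝ) :
    volume {q : ℝ × ℝ | |q.1 + q.2| < Real.pi ∧ |q.1 - q.2| < Real.pi ∧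
        c < Real.cos q.1 + Real.cos q.2} ≤
      2 * volume ({q : ℝ × ℝ | |q.1 + q.2| < Real.pi ∧ |q.1 - q.2| < Real.pi ∧
        c < Real.cos q.1 + Real.cos q.2} ∩ {q | 0 < q.1}) := by
  set R := {q : ℝ × ℝ | |q.1 + q.2| < Real.pi ∧ |q.1 - q.2| < Real.pi ∧
    c < Real.cos q.1 + Real.cos q.2} with hR
  have hsub : R ⊆ (R ∩ {q | q.1 < 0}) ∪ (R ∩ {q | 0 < q.1}) ∪ {q : ℝ × ℝ | q.1 = 0} := by
    intro q hq
    rcases lt_trichotomy q.1 0 with h | h | h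
    · exact Or.inl (Or.inl ⟨hq, h⟩)
    · exact Or.inr h
    · exact Or.inl (Or.inr ⟨hq, h⟩)
  calc volume R ≤ volume ((R ∩ {q | q.1 < 0}) ∪ (R ∩ {q | 0 < q.1}) ∪ {q : ℝ × ℝ | q.1 = 0}) :=
        measure_mono hsub
    _ ≤ volume ((R ∩ {q | q.1 < 0}) ∪ (R ∩ {q | 0 < q.1})) + volume {q : ℝ × ℝ | q.1 = 0} :=
        measure_union_le _ _
    _ ≤ volume (R ∩ {q | q.1 < 0}) + volume (R ∩ {q | 0 < q.1}) + 0 := by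
        rw [Literature.MathematicalPhysics.StatisticalMechanics.HardDiscStarLens.volume_axis]
        exact add_le_add (measure_union_le _ _) le_rfl
    _ = 2 * volume (R ∩ {q | 0 < q.1}) := by rw [add_zero, klfill_volume_neg_half c, two_mul]

/-- **Doubling for inner polygons**: `2 · vol(U) ≤ vol(R_c)` for `U ⊆ R_c ∩ {0 < x}`. [folklore] -/
theorem klfill_two_mul_le_volume (c : ℝ) {U : Set (ℝ × ℝ)}
    (hU : U ⊆ {q : ℝ × ℝ | |q.1 + q.2| < Real.pi ∧ |q.1 - q.2| < Real.pi ∧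
        c < Real.cos q.1 + Real.cos q.2} ∩ {q | 0 < q.1}) :
    2 * volume U ≤ volume {q : ℝ × ℝ | |q.1 + q.2| < Real.pi ∧ |q.1 - q.2| < Real.pi ∧
        c < Real.cos q.1 + Real.cos q.2} := by
  set R := {q : ℝ × ℝ | |q.1 + q.2| < Real.pi ∧ |q.1 - q.2| < Real.pi ∧
    c < Real.cos q.1 + Real.cos q.2} with hR
  have hmeas : MeasurableSet (R ∩ {q | 0 < q.1}) :=
    (measurableSet_fermiSeaCoord c).inter (measurableSet_lt measurable_const measurable_fst)
  have hdisj : Disjoint (R ∩ {q : ℝ × ℝ | q.1 < 0}) (R ∩ {q | 0 < q.1}) := by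
    rw [Set.disjoint_left]
    rintro q ⟨-, h1⟩ ⟨-, h2⟩
    exact lt_irrefl _ (lt_trans (show q.1 < 0 from h1) (show 0 < q.1 from h2))
  have hsub : (R ∩ {q : ℝ × ℝ | q.1 < 0}) ∪ (R ∩ {q | 0 < q.1}) ⊆ R :=
    union_subset inter_subset_left inter_subset_left
  calc 2 * volume U ≤ 2 * volume (R ∩ {q | 0 < q.1}) := by gcongr
    _ = volume (R ∩ {q : ℝ × ℝ | q.1 < 0}) + volume (R ∩ {q | 0 < q.1}) := by
        rw [two_mul, klfill_volume_neg_half c]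
    _ = volume ((R ∩ {q : ℝ × ℝ | q.1 < 0}) ∪ (R ∩ {q | 0 < q.1})) := (measure_union hdisj hmeas).symm
    _ ≤ volume R := measure_mono hsub

/-! ### Bookkeeping for circumscribed polygons -/

/-- **Cover step.** If `R ∩ {0 < x ≤ s} ⊆ U` with `vol U ≤ a` and the part of `R` over `(s, t]`
lies in `P` with `vol P = b`, then `R ∩ {0 < x ≤ t} ⊆ U ∪ P` and `vol (U ∪ P) ≤ a + b`. [folklore] -/
theorem klfill_cover_step {R U P : Set (ℝ × ℝ)} {s t a b : ℝ}
    (hU : R ∩ {q | 0 < q.1 ∧ q.1 ≤ s} ⊆ U) (hvolU : volume U ≤ ENNReal.ofReal a) (ha : 0 ≤ a)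
    (hP : R ∩ (Ioc s t ×ˢ (univ : Set ℝ)) ⊆ P) (hvolP : volume P = ENNReal.ofReal b) (hb : 0 ≤ b) :
    R ∩ {q | 0 < q.1 ∧ q.1 ≤ t} ⊆ U ∪ P ∧ volume (U ∪ P) ≤ ENNReal.ofReal (a + b) ∧ 0 ≤ a + b := by
  refine ⟨?_, ?_, add_nonneg ha hb⟩
  · rintro q ⟨hqR, hq0, hqt⟩
    rcases le_or_gt q.1 s with h | h
    · exact Or.inl (hU ⟨hqR, hq0, h⟩)
    · exact Or.inr (hP ⟨hqR, ⟨h, hqt⟩, mem_univ _⟩)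
  · calc volume (U ∪ P) ≤ volume U + volume P := measure_union_le _ _
      _ ≤ ENNReal.ofReal a + ENNReal.ofReal b := add_le_add hvolU hvolP.le
      _ = ENNReal.ofReal (a + b) := (ENNReal.ofReal_add ha hb).symm

/-- Start of the cover bookkeeping: nothing lies over `{0 < x ≤ 0}`. [folklore] -/
theorem klfill_cover_start (R : Set (ℝ × ℝ)) :
    R ∩ {q : ℝ × ℝ | 0 < q.1 ∧ q.1 ≤ 0} ⊆ (∅ : Set (ℝ × ℝ)) ∧
      volume (∅ : Set (ℝ × ℝ)) ≤ ENNReal.ofReal 0 ∧ (0 : ℝ) ≤ 0 := by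
  refine ⟨?_, by simp, le_rfl⟩
  rintro q ⟨-, h1, h2⟩
  exact absurd (lt_of_lt_of_le h1 h2) (lt_irrefl _)

/-- **End of the cover bookkeeping**: with the vertical cut `R_c ⊆ {x < X}` the half `R_c ∩ {0 < x}`
is the part over `{0 < x ≤ X}`, so `vol(R_c) ≤ 2 a`. [folklore] -/
theorem klfill_volume_le_of_cover {c X a : ℝ} {U : Set (ℝ × ℝ)} (hX0 : 0 ≤ X)
    (hcos : Real.cos X ≤ c - 1)
    (hU : {q : ℝ × ℝ | |q.1 + q.2| < Real.pi ∧ |q.1 - q.2| < Real.pi ∧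
        c < Real.cos q.1 + Real.cos q.2} ∩ {q | 0 < q.1 ∧ q.1 ≤ X} ⊆ U)
    (hvolU : volume U ≤ ENNReal.ofReal a) :
    volume {q : ℝ × ℝ | |q.1 + q.2| < Real.pi ∧ |q.1 - q.2| < Real.pi ∧
        c < Real.cos q.1 + Real.cos q.2} ≤ ENNReal.ofReal (2 * a) := by
  refine (klfill_volume_le_two_mul_half c).trans ?_
  have hsub : {q : ℝ × ℝ | |q.1 + q.2| < Real.pi ∧ |q.1 - q.2| < Real.pi ∧
        c < Real.cos q.1 + Real.cos q.2} ∩ {q | 0 < q.1} ⊆ U := by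
    rintro q ⟨hq, h0⟩
    exact hU ⟨hq, h0, (klfill_fst_lt hX0 hcos hq).le⟩
  calc 2 * volume ({q : ℝ × ℝ | |q.1 + q.2| < Real.pi ∧ |q.1 - q.2| < Real.pi ∧
          c < Real.cos q.1 + Real.cos q.2} ∩ {q | 0 < q.1})
        ≤ 2 * ENNReal.ofReal a := by gcongr; exact (measure_mono hsub).trans hvolU
    _ = ENNReal.ofReal (2 * a) := by
        rw [ENNReal.ofReal_mul (by norm_num : (0:ℝ) ≤ 2), ENNReal.ofReal_ofNat]

/-! ### Transport to momentum space (upper bounds) -/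

/-- **The occupied region is the coordinate Fermi sea** (`c > 0`): an occupied momentum of the
Brillouin zone at energy `-2c` has its coordinate pair in `R_c` (`cos x + cos y > c > 0` with
`|x|, |y| ≤ π` forces `|x| + |y| < π`). [folklore] -/
theorem klfill_occupied_subset_preimage {c : ℝ} (hc : 0 < c) :
    {p : Momentum | squareDispersion 1 0 p < -2 * c} ∩ brillouinZone ⊆
      (fun k : Momentum => ((k 0, k 1) : ℝ × ℝ)) ⁻¹'
        {q : ℝ × ℝ | |q.1 + q.2| < Real.pi ∧ |q.1 - q.2| < Real.pi ∧
          c < Real.cos q.1 + Real.cos q.2} := by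
  rintro p ⟨hp1, hp2⟩
  simp only [mem_setOf_eq, squareDispersion] at hp1
  have hsum : c < Real.cos (p 0) + Real.cos (p 1) := by linarith
  have habs : ∀ i, |p i| ≤ Real.pi := fun i => by
    have := hp2 i
    rw [abs_le]; exact ⟨this.1, this.2.le⟩
  -- `|x| + |y| < π`: otherwise `cos y ≤ cos (π - |x|) = -cos x`
  have hxy : |p 0| + |p 1| < Real.pi := by
    by_contra hge
    push Not at hge
    have h1 : Real.pi - |p 0| ≤ |p 1| := by linarith
    have h0 : 0 ≤ Real.pi - |p 0| := by linarith [habs 0]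
    have hcos : Real.cos |p 1| ≤ Real.cos (Real.pi - |p 0|) :=
      Real.cos_le_cos_of_nonneg_of_le_pi h0 (habs 1) h1
    rw [Real.cos_pi_sub, Real.cos_abs, Real.cos_abs] at hcos
    linarith
  exact mem_fermiSeaCoord hxy hsum

/-- **Upper bounds transport**: for `c > 0` the occupied volume at energy `-2c` is at most the
volume of `R_c` (`measurePreserving_momentum_prod`; with `volume_fermiSeaCoord_le` an equality).
[folklore] -/
theorem klfill_volume_occupied_le {c : ℝ} (hc : 0 < c) :
    volume ({p : Momentum | squareDispersion 1 0 p < -2 * c} ∩ brillouinZone) ≤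
      volume {q : ℝ × ℝ | |q.1 + q.2| < Real.pi ∧ |q.1 - q.2| < Real.pi ∧
        c < Real.cos q.1 + Real.cos q.2} := by
  rw [← measurePreserving_momentum_prod.measure_preimage
    (measurableSet_fermiSeaCoord c).nullMeasurableSet]
  exact measure_mono (klfill_occupied_subset_preimage hc)

/-- **From a coordinate area bound to a filling upper bound**: if `vol(R_c) ≤ A` and
`2 A ≤ n₀ (2 · 3.141592)²` then `n(-2c) ≤ n₀`. [folklore] -/
theorem klfill_filling_le_of_volume_le {c A n₀ : ℝ} (hc : 0 < c)
    (hV : volume {q : ℝ × ℝ | |q.1 + q.2| < Real.pi ∧ |q.1 - q.2| < Real.pi ∧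
        c < Real.cos q.1 + Real.cos q.2} ≤ ENNReal.ofReal A) (hA : 0 ≤ A)
    (hnum : 2 * A ≤ n₀ * (2 * 3.141592) ^ 2) :
    KohnLuttinger.filling (squareDispersion 1 0) (-2 * c) ≤ n₀ := by
  rw [kl_mu_filling_eq]
  have hfin := (kl_mu_volume_occupied_lt_top (-2 * c)).ne
  have hV' : (volume ({p : Momentum | squareDispersion 1 0 p < -2 * c} ∩ brillouinZone)).toReal ≤ A := by
    have := (klfill_volume_occupied_le hc).trans hV
    exact (ENNReal.toReal_le_toReal hfin ENNReal.ofReal_ne_top).2 this |>.trans (by rw [ENNReal.toReal_ofReal hA])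
  have hpi := Real.pi_gt_d6
  have hpi0 := Real.pi_pos
  have hpi2 : (2 * 3.141592) ^ 2 ≤ (2 * Real.pi) ^ 2 := by gcongr
  rw [div_le_iff₀ (by positivity)]
  nlinarith

/-- **From a coordinate area bound to a filling lower bound**: if `A ≤ vol(R_c)` and
`n₀ (2 · 3.141593)² ≤ 2 A` then `n₀ ≤ n(-2c)`. [folklore] -/
theorem klfill_le_filling_of_le_volume {c A n₀ : ℝ}
    (hV : ENNReal.ofReal A ≤ volume {q : ℝ × ℝ | |q.1 + q.2| < Real.pi ∧ |q.1 - q.2| < Real.pi ∧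
        c < Real.cos q.1 + Real.cos q.2}) (hn₀ : 0 ≤ n₀)
    (hnum : n₀ * (2 * 3.141593) ^ 2 ≤ 2 * A) :
    n₀ ≤ KohnLuttinger.filling (squareDispersion 1 0) (-2 * c) := by
  rw [kl_mu_filling_eq]
  have hfin := (kl_mu_volume_occupied_lt_top (-2 * c)).ne
  have hV' : A ≤ (volume ({p : Momentum | squareDispersion 1 0 p < -2 * c} ∩ brillouinZone)).toReal :=
    (ENNReal.ofReal_le_iff_le_toReal hfin).1 (hV.trans (volume_fermiSeaCoord_le c))
  have hpi := Real.pi_lt_d6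
  have hpi0 := Real.pi_pos
  have hpi2 : (2 * Real.pi) ^ 2 ≤ (2 * 3.141593) ^ 2 := by gcongr
  rw [le_div_iff₀ (by positivity)]
  nlinarith

end Summit.HubbardSuperconductivity.HubbardSuperconductivity.Theorems

end
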